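import Mathlib
import HarnessLib
import Literature.MathematicalPhysics.StatisticalMechanics.GaussianWeightStepRenorm
import Literature.Analysis.Matrix.RegulatorSubcriticality

/-!
# The next-scale weight form is monotone in the weight (Adams–Buchholz–Kotecký–Müller, Lemma 7.2)

[ABKM19] Lemma 7.2 records the classical matrix-monotonicity facts behind the large-field weights
of Ch. 7: the map `f(A) = (A⁻¹ − C)⁻¹`, extended by Lemma 7.2 (iii) to `0 ≤ A < C⁻¹` as
`A^{1/2}(1 − A^{1/2} C A^{1/2})⁻¹A^{1/2}` ((7.22)), is MATRIX MONOTONE; this is what makes the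
recursion (7.5) `A_k^X ↦ A_{k:k+1}^X` respect `Y ⊆ X` (Theorem 7.1 (w1), Lemma 7.5 (iv)) and what
transports the upper bounds (7.30) along the scales (Lemma 7.5 (v)).

In the tree the invertibility-free next-scale form is `nextForm A C = A + A√C(1 − √CA√C)⁻¹√CA`
(`GaussianWeightStep.lean`; `= A(1 − CA)⁻¹`, `GaussianWeightStepRenorm.lean`).  This file proves
Lemma 7.2 for it WITHOUT limits or pseudo-inverses, from a variational characterisation
(completing the square in the Gaussian exponent):

* `quadForm_sub_sqrt_mulVec_le` / `_eq` — for symmetric `A` with `R = 1 − √CA√C ≻ 0`,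
  `(v − √C w)ᵀ A (v − √C w) ≤ vᵀ f(A) v + wᵀ w` for all `v, w`, with equality at
  `w = −R⁻¹ √C A v`;
* `nextForm_le_iff` — hence for symmetric `X`: `f(A) ⪯ X ↔ ∀ v w, (v − √Cw)ᵀA(v − √Cw) ≤ vᵀXv + wᵀw`
  (the right-hand side is visibly monotone in `A`);
* `isSymm_nextForm`, `posSemidef_nextForm_sub` (`A ⪯ f(A)`), `posSemidef_nextForm` (`0 ⪯ A ⇒ 0 ⪯ f(A)`)
  — Lemma 7.5 (i): the forms `A_{k:k+1}^X` are symmetric and non-negative;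
* **`nextForm_mono`** — `A₁ ⪯ A₂`, `1 − √CA₂√C ≻ 0 ⇒ f(A₁) ⪯ f(A₂)` (Lemma 7.2 (ii)–(iii));
* `nextForm_inv_eq` — `f(P⁻¹) = (P − C)⁻¹` for `P ≻ 0`, `C ⪰ 0`, `P − C ≻ 0` (the formula
  `(A⁻¹ − C)⁻¹` itself), with `posDef_one_sub_sqrt_inv_sqrt` (`P − C ≻ 0 ⇒ 1 − √C P⁻¹ √C ≻ 0`);
* **`nextForm_le_inv_sub`** — the transport of upper bounds used in Lemma 7.5 (v) ((7.43)):
  `A ⪯ P⁻¹`, `P − C ≻ 0 ⇒ f(A) ⪯ (P − C)⁻¹`.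

Everything is proved; no named fact.  What is NOT here: monotonicity of `f` in the covariance `C`,
and the Neumann series (7.23).

## References
* S. Adams, S. Buchholz, R. Kotecký, S. Müller, arXiv:1910.13564, Lemma 7.2, Lemma 7.5 (i),(iv),(v)
  [AdamsBuchholzKoteckyMuller2019].
-/

noncomputable section

open Matrix
open scoped Matrix MatrixOrder

namespace Literature.MathematicalPhysics.StatisticalMechanics.GradientRG

open Literature.MathematicalPhysics.QuantumFieldTheory
open Literature.Analysis.Matrix (posSemidef_cfcSqrt conjTranspose_cfcSqrt)

variable {ι : Type*} [Fintype ι] [DecidableEq ι]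

/-! ## Dot-product bookkeeping for symmetric matrices -/

omit [DecidableEq ι] in
/-- `(S w)·z = w·(S z)` for symmetric `S`. [folklore] -/
private theorem mulVec_dotProduct_of_isSymm {S : Matrix ι ι ℝ} (hS : S.IsSymm) (w z : ι → ℝ) :
    (S *ᵥ w) ⬝ᵥ z = w ⬝ᵥ (S *ᵥ z) := by
  have hSt : Sᵀ = S := hS
  rw [Matrix.dotProduct_mulVec w S z, ← Matrix.mulVec_transpose, hSt]

omit [DecidableEq ι] in
/-- Expansion of `(v − y)ᵀA(v − y)` for symmetric `A`. [folklore] -/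
private theorem sub_dotProduct_mulVec_sub_of_isSymm {A : Matrix ι ι ℝ} (hA : A.IsSymm) (v y : ι → ℝ) :
    (v - y) ⬝ᵥ A *ᵥ (v - y) = v ⬝ᵥ A *ᵥ v - 2 * (y ⬝ᵥ A *ᵥ v) + y ⬝ᵥ A *ᵥ y := by
  have h1 : v ⬝ᵥ A *ᵥ y = y ⬝ᵥ A *ᵥ v := by
    rw [← mulVec_dotProduct_of_isSymm hA v y, dotProduct_comm]
  rw [Matrix.mulVec_sub, sub_dotProduct, dotProduct_sub, dotProduct_sub, h1]
  ring

/-- **Completing the square**: for symmetric `R` with `det R` a unit and `u = R⁻¹ b`,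
`wᵀRw + 2 wᵀb = (w + u)ᵀR(w + u) − bᵀR⁻¹b`. [folklore] -/
private theorem dotProduct_mulVec_add_two_mul_eq {R : Matrix ι ι ℝ} (hR : R.IsSymm) (hU : IsUnit R.det)
    (w b : ι → ℝ) :
    w ⬝ᵥ R *ᵥ w + 2 * (w ⬝ᵥ b) =
      (w + R⁻¹ *ᵥ b) ⬝ᵥ R *ᵥ (w + R⁻¹ *ᵥ b) - b ⬝ᵥ R⁻¹ *ᵥ b := by
  set u := R⁻¹ *ᵥ b with hu
  have hRu : R *ᵥ u = b := by rw [hu, Matrix.mulVec_mulVec, Matrix.mul_nonsing_inv R hU, one_mulVec]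
  have h1 : u ⬝ᵥ R *ᵥ w = b ⬝ᵥ w := by rw [← mulVec_dotProduct_of_isSymm hR u w, hRu]
  have h2 : w ⬝ᵥ R *ᵥ u = w ⬝ᵥ b := by rw [hRu]
  have h3 : u ⬝ᵥ R *ᵥ u = b ⬝ᵥ u := by rw [hRu, dotProduct_comm]
  rw [Matrix.mulVec_add, add_dotProduct, dotProduct_add, dotProduct_add, h1, h2, h3, dotProduct_comm b w]
  ring

/-! ## The variational characterisation of `nextForm` -/

/-- The residual form `R = 1 − √C A √C` is symmetric for symmetric `A`.
[cite: AdamsBuchholzKoteckyMuller2019, Lemma 7.2 (iv)] -/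
theorem isSymm_one_sub_sqrt_mul_sqrt {A : Matrix ι ι ℝ} (hA : A.IsSymm) (C : Matrix ι ι ℝ) :
    ((1 : Matrix ι ι ℝ) - CFC.sqrt C * A * CFC.sqrt C).IsSymm := by
  have hAt : Aᵀ = A := hA
  have hRt : (CFC.sqrt C)ᵀ = CFC.sqrt C := GaussianToolkit.transpose_sqrt (S := C)
  show ((1 : Matrix ι ι ℝ) - CFC.sqrt C * A * CFC.sqrt C)ᵀ = _
  rw [Matrix.transpose_sub, Matrix.transpose_one, Matrix.transpose_mul, Matrix.transpose_mul, hAt,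
    hRt, Matrix.mul_assoc]

/-- **Completing the square in the Gaussian exponent**: for symmetric `A` with
`R = 1 − √C A √C ≻ 0`, every `v, w` satisfy
`(v − √C w)ᵀ A (v − √C w) − wᵀw = vᵀ f(A) v − (w + R⁻¹√CAv)ᵀ R (w + R⁻¹√CAv)`, `f = nextForm · C`.
[cite: AdamsBuchholzKoteckyMuller2019, Lemma 7.2 (iv)] -/
theorem quadForm_sub_sqrt_mulVec_eq_sub {A : Matrix ι ι ℝ} (hA : A.IsSymm) {C : Matrix ι ι ℝ}
    (hR : ((1 : Matrix ι ι ℝ) - CFC.sqrt C * A * CFC.sqrt C).PosDef) (v w : ι → ℝ) :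
    (v - CFC.sqrt C *ᵥ w) ⬝ᵥ A *ᵥ (v - CFC.sqrt C *ᵥ w) - w ⬝ᵥ w =
      v ⬝ᵥ nextForm A C *ᵥ v -
        (w + ((1 : Matrix ι ι ℝ) - CFC.sqrt C * A * CFC.sqrt C)⁻¹ *ᵥ
            (CFC.sqrt C *ᵥ (A *ᵥ v))) ⬝ᵥ
          ((1 : Matrix ι ι ℝ) - CFC.sqrt C * A * CFC.sqrt C) *ᵥ
          (w + ((1 : Matrix ι ι ℝ) - CFC.sqrt C * A * CFC.sqrt C)⁻¹ *ᵥ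
            (CFC.sqrt C *ᵥ (A *ᵥ v))) := by
  set S := CFC.sqrt C with hS
  set R : Matrix ι ι ℝ := 1 - S * A * S with hRdef
  set b := S *ᵥ (A *ᵥ v) with hb
  have hSsym : S.IsSymm := GaussianToolkit.transpose_sqrt (S := C)
  have hRsym : R.IsSymm := isSymm_one_sub_sqrt_mul_sqrt hA C
  have hRU : IsUnit R.det := (Matrix.isUnit_iff_isUnit_det _).1 hR.isUnit
  -- expand `(v − Sw)ᵀA(v − Sw)`
  have hyAv : (S *ᵥ w) ⬝ᵥ A *ᵥ v = w ⬝ᵥ b := by rw [mulVec_dotProduct_of_isSymm hSsym, hb]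
  have hyAy : (S *ᵥ w) ⬝ᵥ A *ᵥ (S *ᵥ w) = w ⬝ᵥ (S * A * S) *ᵥ w := by
    rw [mulVec_dotProduct_of_isSymm hSsym, Matrix.mulVec_mulVec, Matrix.mulVec_mulVec]
  have hRw : w ⬝ᵥ R *ᵥ w = w ⬝ᵥ w - w ⬝ᵥ (S * A * S) *ᵥ w := by
    rw [hRdef, Matrix.sub_mulVec, Matrix.one_mulVec, dotProduct_sub]
  have hsq := dotProduct_mulVec_add_two_mul_eq hRsym hRU w b
  rw [sub_dotProduct_mulVec_sub_of_isSymm hA, hyAv, hyAy, quadForm_nextForm hA C v, ← hb]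
  linarith [hsq, hRw]

/-- **Upper bound** ([ABKM19] Lemma 7.2, variational form): for symmetric `A` with
`1 − √C A √C ≻ 0` and all `v, w`, `(v − √C w)ᵀ A (v − √C w) ≤ vᵀ f(A) v + wᵀ w`.
[cite: AdamsBuchholzKoteckyMuller2019, Lemma 7.2 (iv)] -/
theorem quadForm_sub_sqrt_mulVec_le {A : Matrix ι ι ℝ} (hA : A.IsSymm) {C : Matrix ι ι ℝ}
    (hR : ((1 : Matrix ι ι ℝ) - CFC.sqrt C * A * CFC.sqrt C).PosDef) (v w : ι → ℝ) :
    (v - CFC.sqrt C *ᵥ w) ⬝ᵥ A *ᵥ (v - CFC.sqrt C *ᵥ w) ≤ v ⬝ᵥ nextForm A C *ᵥ v + w ⬝ᵥ w := by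
  have h := quadForm_sub_sqrt_mulVec_eq_sub hA hR v w
  have hnn := hR.posSemidef.dotProduct_mulVec_nonneg
    (w + ((1 : Matrix ι ι ℝ) - CFC.sqrt C * A * CFC.sqrt C)⁻¹ *ᵥ (CFC.sqrt C *ᵥ (A *ᵥ v)))
  rw [star_trivial] at hnn
  linarith

/-- **The bound is attained**: with `w₀ = −R⁻¹ √C A v`,
`(v − √C w₀)ᵀ A (v − √C w₀) = vᵀ f(A) v + w₀ᵀ w₀`.
[cite: AdamsBuchholzKoteckyMuller2019, Lemma 7.2 (iv)] -/
theorem quadForm_sub_sqrt_mulVec_eq {A : Matrix ι ι ℝ} (hA : A.IsSymm) {C : Matrix ι ι ℝ}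
    (hR : ((1 : Matrix ι ι ℝ) - CFC.sqrt C * A * CFC.sqrt C).PosDef) (v : ι → ℝ) :
    (v - CFC.sqrt C *ᵥ (-(((1 : Matrix ι ι ℝ) - CFC.sqrt C * A * CFC.sqrt C)⁻¹ *ᵥ
        (CFC.sqrt C *ᵥ (A *ᵥ v))))) ⬝ᵥ A *ᵥ
      (v - CFC.sqrt C *ᵥ (-(((1 : Matrix ι ι ℝ) - CFC.sqrt C * A * CFC.sqrt C)⁻¹ *ᵥ
        (CFC.sqrt C *ᵥ (A *ᵥ v))))) =
      v ⬝ᵥ nextForm A C *ᵥ v +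
        (-(((1 : Matrix ι ι ℝ) - CFC.sqrt C * A * CFC.sqrt C)⁻¹ *ᵥ (CFC.sqrt C *ᵥ (A *ᵥ v)))) ⬝ᵥ
        (-(((1 : Matrix ι ι ℝ) - CFC.sqrt C * A * CFC.sqrt C)⁻¹ *ᵥ (CFC.sqrt C *ᵥ (A *ᵥ v)))) := by
  have h := quadForm_sub_sqrt_mulVec_eq_sub hA hR v
    (-(((1 : Matrix ι ι ℝ) - CFC.sqrt C * A * CFC.sqrt C)⁻¹ *ᵥ (CFC.sqrt C *ᵥ (A *ᵥ v))))
  rw [neg_add_cancel, Matrix.mulVec_zero, dotProduct_zero, sub_zero] at h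
  linarith

/-- `nextForm A C` is symmetric for symmetric `A` ([ABKM19] Lemma 7.5 (i)).
[cite: AdamsBuchholzKoteckyMuller2019, Lemma 7.5 (i)] -/
theorem isSymm_nextForm {A : Matrix ι ι ℝ} (hA : A.IsSymm) (C : Matrix ι ι ℝ) :
    (nextForm A C).IsSymm := by
  have hAt : Aᵀ = A := hA
  have hSt : (CFC.sqrt C)ᵀ = CFC.sqrt C := GaussianToolkit.transpose_sqrt (S := C)
  have hRt : (((1 : Matrix ι ι ℝ) - CFC.sqrt C * A * CFC.sqrt C)⁻¹)ᵀ =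
      ((1 : Matrix ι ι ℝ) - CFC.sqrt C * A * CFC.sqrt C)⁻¹ := by
    rw [Matrix.transpose_nonsing_inv]
    exact congrArg _ (isSymm_one_sub_sqrt_mul_sqrt hA C)
  show (nextForm A C)ᵀ = nextForm A C
  unfold nextForm
  rw [Matrix.transpose_add, hAt, Matrix.transpose_mul, Matrix.transpose_mul, Matrix.transpose_mul,
    Matrix.transpose_mul, hAt, hSt, hRt]
  simp only [Matrix.mul_assoc]

/-- **`f(A) ⪯ X` iff the variational bound holds with `X`** ([ABKM19] Lemma 7.2 in the form used
here): for symmetric `A`, `X` with `1 − √C A √C ≻ 0`,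
`X − nextForm A C ⪰ 0 ↔ ∀ v w, (v − √Cw)ᵀA(v − √Cw) ≤ vᵀXv + wᵀw`.
[cite: AdamsBuchholzKoteckyMuller2019, Lemma 7.2 (ii)-(iv)] -/
theorem nextForm_le_iff {A X : Matrix ι ι ℝ} (hA : A.IsSymm) (hX : X.IsSymm) {C : Matrix ι ι ℝ}
    (hR : ((1 : Matrix ι ι ℝ) - CFC.sqrt C * A * CFC.sqrt C).PosDef) :
    (X - nextForm A C).PosSemidef ↔
      ∀ v w : ι → ℝ, (v - CFC.sqrt C *ᵥ w) ⬝ᵥ A *ᵥ (v - CFC.sqrt C *ᵥ w) ≤ v ⬝ᵥ X *ᵥ v + w ⬝ᵥ w := by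
  have hsymm : (X - nextForm A C).IsHermitian := by
    have h1 : Xᵀ = X := hX
    have h2 : (nextForm A C)ᵀ = nextForm A C := isSymm_nextForm hA C
    show (X - nextForm A C)ᴴ = _
    rw [Matrix.conjTranspose_eq_transpose_of_trivial, Matrix.transpose_sub, h1, h2]
  constructor
  · intro h v w
    have h1 := quadForm_sub_sqrt_mulVec_le hA hR v w
    have h2 := h.dotProduct_mulVec_nonneg v
    rw [star_trivial, Matrix.sub_mulVec, dotProduct_sub] at h2
    linarith
  · intro h
    refine Matrix.PosSemidef.of_dotProduct_mulVec_nonneg hsymm fun v => ?_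
    rw [star_trivial, Matrix.sub_mulVec, dotProduct_sub]
    have h1 := quadForm_sub_sqrt_mulVec_eq hA hR v
    have h2 := h v (-(((1 : Matrix ι ι ℝ) - CFC.sqrt C * A * CFC.sqrt C)⁻¹ *ᵥ
      (CFC.sqrt C *ᵥ (A *ᵥ v))))
    linarith

/-! ## Lemma 7.5 (i): symmetric, non-negative, above `A` -/

/-- **`A ⪯ f(A)`**: `nextForm A C − A ⪰ 0` for symmetric `A` with `1 − √CA√C ≻ 0` (the Gaussian step
only ENLARGES the weight form). [cite: AdamsBuchholzKoteckyMuller2019, Lemma 7.2 (7.23)] -/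
theorem posSemidef_nextForm_sub {A : Matrix ι ι ℝ} (hA : A.IsSymm) {C : Matrix ι ι ℝ}
    (hR : ((1 : Matrix ι ι ℝ) - CFC.sqrt C * A * CFC.sqrt C).PosDef) :
    (nextForm A C - A).PosSemidef := by
  have hsymm : (nextForm A C - A).IsHermitian := by
    have h1 : Aᵀ = A := hA
    have h2 : (nextForm A C)ᵀ = nextForm A C := isSymm_nextForm hA C
    show (nextForm A C - A)ᴴ = _
    rw [Matrix.conjTranspose_eq_transpose_of_trivial, Matrix.transpose_sub, h1, h2]
  refine Matrix.PosSemidef.of_dotProduct_mulVec_nonneg hsymm fun v => ?_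
  rw [star_trivial, Matrix.sub_mulVec, dotProduct_sub, quadForm_nextForm hA C v]
  have h := hR.inv.posSemidef.dotProduct_mulVec_nonneg (CFC.sqrt C *ᵥ (A *ᵥ v))
  rw [star_trivial] at h
  linarith

/-- **`0 ⪯ A ⇒ 0 ⪯ f(A)`** ([ABKM19] Lemma 7.5 (i): the forms `A_{k:k+1}^X` are non-negative).
[cite: AdamsBuchholzKoteckyMuller2019, Lemma 7.5 (i)] -/
theorem posSemidef_nextForm {A : Matrix ι ι ℝ} (hA : A.PosSemidef) {C : Matrix ι ι ℝ}
    (hR : ((1 : Matrix ι ι ℝ) - CFC.sqrt C * A * CFC.sqrt C).PosDef) :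
    (nextForm A C).PosSemidef := by
  have hAs : A.IsSymm := by
    have h := hA.1
    rwa [Matrix.IsHermitian, Matrix.conjTranspose_eq_transpose_of_trivial] at h
  have := (posSemidef_nextForm_sub hAs hR).add hA
  rwa [sub_add_cancel] at this

/-! ## Lemma 7.2: monotonicity in the weight form -/

/-- Subcriticality passes DOWN: `A₁ ⪯ A₂`, `1 − √CA₂√C ≻ 0 ⇒ 1 − √CA₁√C ≻ 0`.
[cite: AdamsBuchholzKoteckyMuller2019, Lemma 7.2 (iii)] -/
theorem posDef_one_sub_sqrt_mul_sqrt_anti {A₁ A₂ C : Matrix ι ι ℝ} (h12 : (A₂ - A₁).PosSemidef)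
    (hR₂ : ((1 : Matrix ι ι ℝ) - CFC.sqrt C * A₂ * CFC.sqrt C).PosDef) :
    ((1 : Matrix ι ι ℝ) - CFC.sqrt C * A₁ * CFC.sqrt C).PosDef := by
  have hpsd : ((CFC.sqrt C)ᴴ * (A₂ - A₁) * CFC.sqrt C).PosSemidef := h12.conjTranspose_mul_mul_same _
  rw [conjTranspose_cfcSqrt] at hpsd
  have := hR₂.add_posSemidef hpsd
  convert this using 1
  rw [Matrix.mul_sub, Matrix.sub_mul]
  abel

/-- **[ABKM19] Lemma 7.2 (ii)–(iii): the next-scale form is matrix monotone.** For symmetric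
`A₁ ⪯ A₂` with `1 − √C A₂ √C ≻ 0`: `nextForm A₁ C ⪯ nextForm A₂ C`.
[cite: AdamsBuchholzKoteckyMuller2019, Lemma 7.2 (ii)-(iii)] -/
theorem nextForm_mono {A₁ A₂ : Matrix ι ι ℝ} (hA₁ : A₁.IsSymm) (hA₂ : A₂.IsSymm) {C : Matrix ι ι ℝ}
    (h12 : (A₂ - A₁).PosSemidef)
    (hR₂ : ((1 : Matrix ι ι ℝ) - CFC.sqrt C * A₂ * CFC.sqrt C).PosDef) :
    (nextForm A₂ C - nextForm A₁ C).PosSemidef := by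
  have hR₁ := posDef_one_sub_sqrt_mul_sqrt_anti h12 hR₂
  rw [nextForm_le_iff hA₁ (isSymm_nextForm hA₂ C) hR₁]
  intro v w
  have h1 := quadForm_sub_sqrt_mulVec_le hA₂ hR₂ v w
  have h2 := h12.dotProduct_mulVec_nonneg (v - CFC.sqrt C *ᵥ w)
  rw [star_trivial, Matrix.sub_mulVec, dotProduct_sub] at h2
  linarith

/-! ## The formula `(A⁻¹ − C)⁻¹` and the transport of upper bounds (Lemma 7.5 (v)) -/

/-- For `P ≻ 0`: `√(P⁻¹) P √(P⁻¹) = 1` (the congruence behind "`A < C⁻¹` iff `A^{1/2}CA^{1/2} < 1`").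
[cite: AdamsBuchholzKoteckyMuller2019, Lemma 7.2 (iv) (proof)] -/
theorem sqrt_inv_mul_mul_sqrt_inv {P : Matrix ι ι ℝ} (hP : P.PosDef) :
    CFC.sqrt P⁻¹ * P * CFC.sqrt P⁻¹ = 1 := by
  have hQQ : CFC.sqrt P⁻¹ * CFC.sqrt P⁻¹ = P⁻¹ := GaussianToolkit.sqrt_mul_sqrt hP.inv
  have hPu : IsUnit P.det := (Matrix.isUnit_iff_isUnit_det P).1 hP.isUnit
  -- `√(P⁻¹)` commutes with `P⁻¹`, hence with `P`
  have hcomm : Commute (CFC.sqrt P⁻¹) P⁻¹ := by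
    rw [CFC.sqrt_eq_cfc]
    exact (Commute.refl P⁻¹).cfc_nnreal _
  have hcommP : Commute (CFC.sqrt P⁻¹) P := by
    have h := hcomm.eq
    -- multiply `√ P⁻¹ P⁻¹ = P⁻¹ √` by `P` on both sides
    have h2 : P * (CFC.sqrt P⁻¹ * P⁻¹) * P = P * (P⁻¹ * CFC.sqrt P⁻¹) * P := by rw [h]
    rw [← Matrix.mul_assoc, Matrix.mul_assoc (P * CFC.sqrt P⁻¹), Matrix.nonsing_inv_mul P hPu,
      Matrix.mul_one, ← Matrix.mul_assoc, Matrix.mul_nonsing_inv P hPu, Matrix.one_mul] at h2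
    exact h2.symm
  rw [Matrix.mul_assoc, ← hcommP.eq, ← Matrix.mul_assoc, hQQ, Matrix.nonsing_inv_mul P hPu]

/-- **`P − C ≻ 0 ⇒ 1 − √C P⁻¹ √C ≻ 0`** for `P ≻ 0`, `C ⪰ 0`: the weight form `P⁻¹` is subcritical
for `C` exactly when `C < P` ([ABKM19] Lemma 7.2 (ii): "`A < C⁻¹`").
[cite: AdamsBuchholzKoteckyMuller2019, Lemma 7.2 (ii)] -/
theorem posDef_one_sub_sqrt_inv_sqrt {P C : Matrix ι ι ℝ} (hP : P.PosDef) (hC : C.PosSemidef)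
    (hPC : (P - C).PosDef) : ((1 : Matrix ι ι ℝ) - CFC.sqrt C * P⁻¹ * CFC.sqrt C).PosDef := by
  -- `1 − √(P⁻¹) C √(P⁻¹) = √(P⁻¹)(P − C)√(P⁻¹) ≻ 0`, then flip
  have hQu : IsUnit (CFC.sqrt P⁻¹) := GaussianToolkit.isUnit_sqrt hP.inv
  have h1 : ((1 : Matrix ι ι ℝ) - CFC.sqrt P⁻¹ * C * CFC.sqrt P⁻¹).PosDef := by
    have h := hPC.conjTranspose_mul_mul_same (B := CFC.sqrt P⁻¹)
      (Matrix.mulVec_injective_of_isUnit hQu)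
    rw [conjTranspose_cfcSqrt, Matrix.mul_sub, Matrix.sub_mul, sqrt_inv_mul_mul_sqrt_inv hP] at h
    exact h
  exact Literature.Analysis.Matrix.posDef_one_sub_sqrt_mul_sqrt_symm hP.inv.posSemidef hC h1

/-- **`f(P⁻¹) = (P − C)⁻¹`**: on positive definite forms `nextForm` IS [ABKM19]'s `(A⁻¹ − C)⁻¹`
(`A = P⁻¹`), for `C ⪰ 0` and `P − C ≻ 0`. [cite: AdamsBuchholzKoteckyMuller2019, Lemma 7.2 (7.20)] -/
theorem nextForm_inv_eq {P C : Matrix ι ι ℝ} (hP : P.PosDef) (hC : C.PosSemidef)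
    (hPC : (P - C).PosDef) : nextForm P⁻¹ C = (P - C)⁻¹ := by
  have hPu : IsUnit P.det := (Matrix.isUnit_iff_isUnit_det P).1 hP.isUnit
  have hR := posDef_one_sub_sqrt_inv_sqrt hP hC hPC
  rw [nextForm_eq_mul_inv_of_posDef hC hR]
  -- `1 − C P⁻¹ = (P − C) P⁻¹`
  have h1 : (1 : Matrix ι ι ℝ) - C * P⁻¹ = (P - C) * P⁻¹ := by
    rw [Matrix.sub_mul, Matrix.mul_nonsing_inv P hPu]
  rw [h1, Matrix.mul_inv_rev, Matrix.nonsing_inv_nonsing_inv P hPu, ← Matrix.mul_assoc,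
    Matrix.nonsing_inv_mul P hPu, Matrix.one_mul]

/-- **Transport of upper bounds** ([ABKM19] Lemma 7.5 (v), the step (7.43)/(7.30)): if the symmetric
weight form satisfies `A ⪯ P⁻¹` with `P ≻ 0`, `C ⪰ 0` and `P − C ≻ 0`, then `A` is subcritical for
`C` and `nextForm A C ⪯ (P − C)⁻¹`. [cite: AdamsBuchholzKoteckyMuller2019, Lemma 7.5 (v)] -/
theorem nextForm_le_inv_sub {A P C : Matrix ι ι ℝ} (hA : A.IsSymm) (hP : P.PosDef)
    (hC : C.PosSemidef) (hPC : (P - C).PosDef) (hAP : (P⁻¹ - A).PosSemidef) :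
    ((1 : Matrix ι ι ℝ) - CFC.sqrt C * A * CFC.sqrt C).PosDef ∧
      ((P - C)⁻¹ - nextForm A C).PosSemidef := by
  have hR := posDef_one_sub_sqrt_inv_sqrt hP hC hPC
  have hPis : P⁻¹.IsSymm := by
    have h := hP.inv.1
    rwa [Matrix.IsHermitian, Matrix.conjTranspose_eq_transpose_of_trivial] at h
  refine ⟨posDef_one_sub_sqrt_mul_sqrt_anti hAP hR, ?_⟩
  rw [← nextForm_inv_eq hP hC hPC]
  exact nextForm_mono hA hPis hAP hR

end Literature.MathematicalPhysics.StatisticalMechanics.GradientRG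

end
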